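import Mathlib.Data.Nat.Notation
import Mathlib.Data.Int.Notation
import HarnessLib

/-!
# Hypothesis-sweep records — which PRINTED theorem closes the `p`-part of BSD for a Cremona class, as data
# with an in-kernel recheck of the decision

Topic `NumberTheory/EllipticCurves`; namespace `Literature.NumberTheory.EllipticCurves.HypothesisSweep` (= this
directory).  Companion of `KuriharaCertificates/Schema.lean` (same design: computable DATA records, a decidable
well-formedness-and-recheck predicate, generated sibling files `Records*.lean` proved by `decide`; nothing about
elliptic curves is asserted and nothing here is a named fact).

## What a record records

For an elliptic curve `E/ℚ` of analytic rank `r ∈ {0, 1}` (curve `#1` of a Cremona isogeny class, conductor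
`N < 500 000`; BSD truth is isogeny-invariant — Cassels 1965 — so the class is the unit) and each prime `p` of a
finite exceptional set `S₀(E) ⊇ {2, 3, 5, 7, 11, 13} ∪ {p ∣ N} ∪ {p : E admits a rational p-isogeny} ∪
{p : ρ̄_{E,p} not certified surjective} ∪ {p ∣ #E(ℚ)_tors · ∏ c_ℓ · Ш_an}`, a record stores the HYPOTHESIS BITS of
`(E, p)` that the printed theorems below quantify over — reduction type of `E` at `p`, `a_p`, existence of a rational
`p`-isogeny (`E[p]` reducible), certified surjectivity of `ρ̄_{E,p}`, a ramified Tate prime `q ‖ N`, `q ≠ p`,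
`p ∤ v_q(Δ_min)` ("(ram)"), the `p`-adic valuations of `Ш_an`, of `∏ c_ℓ`, of `L(E,1)/Ω_E` on every optimality
candidate of the class, the minimum over the class of `ord_p Ш_an`, whether the Manin constant of the optimal
curve is known prime to `p`, and for CM curves whether `p` splits or is inert in the CM field — together with the
DECISION the sweep drew from them: the list of applicable theorem rows in the fixed order of `applicable`, the
credited row (the first FLAG-FREE applicable row if any, else the first applicable row with its literal flag), or,
when no row applies, the residual class of `(E, p)` in the classification X1–X12 of the open cases; plus the TAIL
row closing every prime outside `S₀(E)` and the class verdict.  `Curve.consistent` RECOMPUTES the decision from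
the bits (`applicable`, `residual`, `tailOf`, `verdictOf`) and demands agreement; this is what the kernel re-runs
when it checks a generated theorem `theorem sweep_<label> : Swept [ … ] := by decide`.

The bits themselves are INPUTS: they were computed from Cremona's tables `allbsd`/`allcurves`/`opt_man`
[Cremona2006] by two independent engines of the `kurihara` build (seat 1: PARI/GP; seat 2: `sweep2`, exact integer
arithmetic in Python — Tate's algorithm, torsion, division polynomials, isogenies via `X₀(ℓ)` parametrisations,
surjectivity via Serre's 1972 Prop. 19 triples [Serre1972] and Zywina's exceptional set (arXiv:1508.07661 Thm 1.2,
Prop. 6.4) [Zywina2015], cross-checked against Sutherland's `galrep` images) whose per-prime outputs are diffed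
class by class; the generated files name the engine versions and jobs.  A record therefore CLAIMS: "if these bits
are the bits of `E` at `p`, the credited printed theorem, with its hypotheses read verbatim, yields the `p`-part of
the Birch–Swinnerton-Dyer formula for `E`" — the dictionary row ↦ printed statement is the docstring of `Row`.

## The rows (C-ids of the build's RESIDUAL-CASES §a.1; hypotheses verbatim in the cited places)

* `SK`    C1  Skinner, Pacific J. Math. 283 (2016) Thm C: `L(E,1) ≠ 0`, `p ≥ 3`, `E` good ordinary or multiplicative
              at `p`, `E[p]` irreducible, some `q ‖ N`, `q ≠ p` with `E[p]` ramified at `q` ⇒ `|L(E,1)/Ω_E|_p⁻¹ = |#Ш·∏c_ℓ|_p⁻¹`.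
* `BCS`   C2  Burungale–Castella–Skinner, IMRN 2025 Cor. 1.3.1: non-CM, `p > 3` good ordinary, (irr), (im) ⇐ `ρ̄` onto;
              `r ≤ 1` ⇒ `p`-part of BSD.
* `JSW`   C3  Jetchev–Skinner–Wan, Camb. J. Math. 5 (2017) Thm 1.2.1: `r = 1`, `E` semistable, `p ≥ 3` good (if `p = 3`
              supersingular then `a₃ = 0`), `E[p]` irreducible ⇒ `p`-part of BSD [flag `JSWss` at supersingular `p`:
              the supersingular case rests on a then-preprint].
* `CGS`   C6  Castella–Grossi–Skinner, Math. Ann. 393 (2025) Thm 4 + Thm 1: `p > 2` good Eisenstein (rational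
              `p`-isogeny) with `a_p ≢ 1 (mod p)`, `r ≤ 1` ⇒ `p`-part of BSD.
* `BF24`  C8  Burungale–Flach, Camb. J. Math. 12 (2024) Thm 1.1 + Cor. 2: CM, `L(E,1) ≠ 0` ⇒ the BSD formula (every `p`).
* `RUBIN1` C9 Rubin 1991 (Invent. 103) as Miller, LMS JCM 14 (2011) Thm 4.5(2a): CM, `r = 1`, `p` odd split in `K`, good.
* `LLT24` C17 Li–Liu–Tian, Sci. Sinica Math. 54 (2024) Thm 1.1(i): CM, `r = 1`, `p` odd split in `K` (any reduction).
* `KOB13` C10 Kobayashi, Invent. 191 (2013) Cor. 1.4: CM, `r = 1`, `p ≥ 5` good inert [flag `KOB13sec`: located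
              through secondary sources].
* `KATO`  C12 Kato 2004 + Matsuno as Grigorov–Jorza–Patrikis–Stein–Tarniţă, Math. Comp. 78 (2009) Thm 4.1: `L(E,1) ≠ 0`,
              non-CM, `p ≥ 5` good, `ρ̄_{E,p}` surjective, `ord_p(L(E,1)/Ω_E) = 0` on the optimal curve ⇒ `Ш[p^∞] = 0`
              (= `ord_p Ш_an`).
* `WU14`  C14 Wuthrich, Doc. Math. 19 (2014) Prop. 21: `L(E,1) ≠ 0` ⇒ `#Ш ∣ C·(L(E,1)/Ω_E⁺)·#E(ℚ)²_tors/∏_v c_v` with `C`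
              divisible only by `2`, additive primes and primes with `ρ̄` neither surjective nor Borel; so for `p` odd,
              not additive, `ρ̄` surjective or `E[p]` reducible: `ord_p #Ш ≤ ord_p Ш_an`, closing `(E,p)` when some curve
              of the class has `ord_p Ш_an = 0`.
* `KIM0`  C15 C.-H. Kim, Amer. J. Math. 148 (2026) Thm 1.8 (= arXiv:2203.12159 Thm 1.9) with `n = 1`: `p ≥ 5`, `ρ̄`
              surjective, Manin constant prime to `p` (automatic unless `p² ∣ N`, Mazur), `δ̃₁ = L(E,1)/Ω_E` a `p`-unit
              ⇒ `Ш[p^∞] = 0`; closes `(E,p)` when `ord_p(Ш_an · ∏c_ℓ) = 0` (ANY reduction type).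
* `YZ26`  C16 Yan–Zhu, J. Algebra 693 (2026) Thm 4.15: non-CM, `p = 3` good ordinary, (irr), (Im) ⇐ `ρ̄₃` onto or (ram);
              `r ≤ 1` [flag `YZ26at3`, carried literal by the build's convention].
* `GV0`   C7 Greenberg–Vatsal, Invent. Math. 142 (2000) Thm 1.3 with Kato's divisibility and Greenberg, LNM 1716
              (1999) Thm 4.1: non-CM, `r = 0`, `p` odd good ordinary, `E[p]` reducible with kernel character `φ`
              "unramified at `p` and odd, or ramified at `p` and even" — equivalently (`E[p]^ss = ψ ⊕ ωψ⁻¹`, `ψ` the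
              member unramified at `p`) `ψ` ODD; the bit `gvpar` records that parity test [flag `GVchain`: a chain of
              three published results, carried literal by the build's convention]; used at anomalous `p` only (CGS
              closes the others flag-free).
`p = 2` is decided only by a complete 2-descent (row C13, PARI `ellrank`), which this schema does not model: a
non-CM-rank-0 record's entry at `2` is `unattempted`/`Up2` by definition.

Residual classes (RESIDUAL-CASES §a.2): `X1a`/`X1b` good anomalous Eisenstein (`X1a` = `r = 1` with `gvpar` false;
`X1b` = `r = 0`, or `r = 1` with `gvpar` true), `X2` multiplicative Eisenstein, `X3` additive
Eisenstein, `X4` additive irreducible, `X6`/`X7` good supersingular (semistable / not), `X8` `p = 3` supersingular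
`a₃ = ±3`, `X9` good ordinary `p ≥ 5` non-surjective irreducible, `X10b` `p = 3` good ordinary neither surjective nor
(ram), `X11a`/`X11b` multiplicative irreducible (`r = 0` without (ram) / `r = 1`), `X12` CM `r = 1` leftovers, `Up2`.

Not here: the bits' computation, any statement about elliptic curves, the index rows (Kolyvagin / Cha / Jetchev /
Lawson–Wuthrich need a computed Heegner index), `p = 2`.

References: [Skinner2016PacificMC] Thm C; [BurungaleCastellaSkinner2025] Cor. 1.3.1; [JetchevSkinnerWan2017]
Thm 1.2.1; [CastellaGrossiSkinner2025] Thm 4; [BurungaleFlach2024] Cor. 2; [Rubin1991MainConj]; [LiLiuTian2024]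
Thm 1.1; [Kobayashi2013] Cor. 1.4; [GrigorovJorzaPatrikisSteinTarnita2009] Thm 4.1; [Wuthrich2014] Prop. 21;
[Kim2022StructureSelmer] Thm 1.8/1.9; [YanZhu2026] Thm 4.15; [GreenbergVatsal2000] Thm 1.3; [Serre1972] Prop. 19;
[Zywina2015] Thm 1.2; [Cremona2006]; [Miller2011LMS] Thm 4.5.
-/

namespace Literature.NumberTheory.EllipticCurves.HypothesisSweep

/-- The printed theorem rows of the sweep (see the module docstring for the verbatim hypotheses and sources of
each; C-ids of the build's RESIDUAL-CASES §a.1 in brackets): `SK` [C1], `BCS` [C2], `JSW` [C3], `CGS` [C6],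
`BF24` [C8], `RUBIN1` [C9], `LLT24` [C17], `KOB13` [C10], `KATO` [C12], `WU14` [C14], `KIM0` [C15], `YZ26` [C16],
`GV0` [C7].
[cite: Skinner2016PacificMC, Thm C (p. 3)] -/
inductive Row
  | SK | BCS | JSW | CGS | BF24 | RUBIN1 | LLT24 | KOB13 | KATO | WU14 | KIM0 | YZ26 | GV0
  deriving DecidableEq, Repr

/-- Literal flags carried by a credited row: `JSWss` (JSW at a supersingular prime), `KOB13sec` (Kobayashi 2013
located through secondary sources), `YZ26at3` (Yan–Zhu at `p = 3`, the build's convention), `GVchain` (the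
Greenberg–Vatsal + Kato + Greenberg chain of row `GV0`). [folklore] -/
inductive Flag
  | JSWss | KOB13sec | YZ26at3 | GVchain
  deriving DecidableEq, Repr

/-- Residual classes of an open pair `(E, p)` (RESIDUAL-CASES §a.2; module docstring), plus `Up2` = `p = 2` not
attempted (no 2-descent modelled). [folklore] -/
inductive Cls
  | X1a | X1b | X2 | X3 | X4 | X6 | X7 | X8 | X9 | X10b | X11a | X11b | X12 | Up2
  deriving DecidableEq, Repr

/-- Reduction type of `E` at `p`. [folklore] -/
inductive Red
  | goodOrd | goodSS | split | nonsplit | additive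
  deriving DecidableEq, Repr

/-- Status of one `(E, p)` entry. [folklore] -/
inductive Status
  | proved | literal | residue | unattempted
  deriving DecidableEq, Repr

/-- The tail argument for the primes outside `S₀(E)`: `KATO` (rank 0 non-CM: `p ∉ S₀ ⇒ p ≥ 17` good, `ρ̄` onto by
Zywina's exceptional set, `ord_p(L/Ω) = 0`), `JSWBCS` (rank 1 non-CM semistable: JSW at every good `p`, flag at the
supersingular ones; BCS at ordinary ones), `BF24` (CM rank 0), `CMr1` (CM rank 1: Rubin at split, Kobayashi at inert
`p`), `X7T` (rank 1 non-CM not semistable: the good supersingular tail is OPEN), `GaloisUncertified` (Zywina's set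
could not be formed: surjectivity for large `p` not certified). [folklore] -/
inductive Tail
  | KATO | JSWBCS | BF24 | CMr1 | X7T | GaloisUncertified
  deriving DecidableEq, Repr

/-- Class verdict over the ODD primes and the tail (`p = 2` is reported separately). [folklore] -/
inductive Verdict
  | proved | literal | residue
  deriving DecidableEq, Repr

/-- The hypothesis bits of `(E, p)` read by the rows (module docstring).  `ap` = `a_p(E)` (`±1`/`0` at bad `p`);
`isog` = `E` admits a rational `p`-isogeny; `surj` = `ρ̄_{E,p}` certified surjective; `ram` = some `q ‖ N`, `q ≠ p`,
`p ∤ v_q(Δ_min)`; `vSha`, `vTam` = `ord_p` of `Ш_an` and of `∏ c_ℓ` of curve `#1`; `vShaMinClass` = `min` over the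
isogeny class of `ord_p Ш_an`; `vLOmOpt` = `ord_p(L(E',1)/Ω_{E'})` for every optimality candidate `E'` (rank 0; `[]`
otherwise); `maninOk` = the optimal curve is determined and its Manin constant is prime to `p`; `cmSplit`/`cmInert` =
`p` split / inert in the CM field (both `false`: ramified, or `E` non-CM); `gvpar` = the Greenberg–Vatsal parity test
of row `GV0` holds (`E[p]` reducible at good ordinary odd `p`, and the `p`-unramified character of `E[p]^ss` is odd;
`false` when it fails or does not apply). [folklore] -/
structure Bits where
  p : ℕ
  red : Red
  ap : ℤ
  isog : Bool
  surj : Bool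
  ram : Bool
  vSha : ℕ
  vShaMinClass : ℕ
  vTam : ℕ
  vLOmOpt : List ℤ
  maninOk : Bool
  cmSplit : Bool
  cmInert : Bool
  gvpar : Bool
  deriving DecidableEq, Repr

namespace Bits

/-- good reduction at `p`. [folklore] -/
def good (b : Bits) : Bool := b.red == .goodOrd || b.red == .goodSS
/-- good ordinary. [folklore] -/
def ord (b : Bits) : Bool := b.red == .goodOrd
/-- good supersingular. [folklore] -/
def ss (b : Bits) : Bool := b.red == .goodSS
/-- multiplicative. [folklore] -/
def mult (b : Bits) : Bool := b.red == .split || b.red == .nonsplit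
/-- additive. [folklore] -/
def add (b : Bits) : Bool := b.red == .additive
/-- anomalous: good and `a_p ≡ 1 (mod p)`. [folklore] -/
def anom (b : Bits) : Bool := b.good && ((b.ap - 1) % (b.p : ℤ) == 0)
/-- `E[p]` irreducible (no rational `p`-isogeny). [folklore] -/
def irr (b : Bits) : Bool := !b.isog

end Bits

/-- The class-level data read by the rows: analytic rank, CM, semistable. [folklore] -/
structure Header where
  rank : ℕ
  cm : Bool
  sst : Bool
  deriving DecidableEq, Repr

/-- The APPLICABLE ROWS at `(E, p)` in the sweep's fixed order (the build's HYPOTHESES v2 / SWEEP-SPEC §2), each with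
its literal flag if any.  Every clause is the verbatim hypothesis list of the row (module docstring) evaluated on the
bits; `p = 2` has no row except `BF24`. [cite: Wuthrich2014, Prop. 21 (p. 400)] -/
def applicable (h : Header) (b : Bits) : List (Row × Option Flag) :=
  let r := h.rank
  let p := b.p
  if h.cm then
    if r == 0 then [(.BF24, none)]
    else if p == 2 then []
    else
      (if b.cmSplit && b.good then [(.RUBIN1, none)] else []) ++
      (if b.cmSplit then [(.LLT24, none)] else []) ++
      (if decide (5 ≤ p) && b.good && b.cmInert then [(.KOB13, some .KOB13sec)] else [])
  else if p == 2 then []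
  else if b.isog then
    (if b.good && !b.anom then [(.CGS, none)] else []) ++
    (if r == 0 && !b.add && b.vShaMinClass == 0 then [(.WU14, none)] else []) ++
    (if r == 0 && decide (3 ≤ p) && b.ord && b.anom && b.gvpar then [(.GV0, some .GVchain)] else [])
  else if r == 0 then
    (if decide (3 ≤ p) && (b.ord || b.mult) && b.ram then [(.SK, none)] else []) ++
    (if decide (5 ≤ p) && b.ord && b.surj then [(.BCS, none)] else []) ++
    (if p == 3 && b.ord && (b.surj || b.ram) then [(.YZ26, some .YZ26at3)] else []) ++
    (if decide (5 ≤ p) && b.good && b.surj && b.vLOmOpt.all (· == 0) then [(.KATO, none)] else []) ++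
    (if !b.add && b.surj && b.vShaMinClass == 0 then [(.WU14, none)] else []) ++
    (if decide (5 ≤ p) && b.surj && (!b.add || b.maninOk) && b.vSha == 0 && b.vTam == 0 then [(.KIM0, none)] else [])
  else
    (if h.sst && b.good && (decide (5 ≤ p) || (p == 3 && (b.ord || b.ap == 0)))
      then [(.JSW, if b.ss then some .JSWss else none)] else []) ++
    (if decide (5 ≤ p) && b.ord && b.surj then [(.BCS, none)] else []) ++
    (if p == 3 && b.ord && (b.surj || b.ram) then [(.YZ26, some .YZ26at3)] else [])

/-- The RESIDUAL CLASS of an open pair (no applicable row), RESIDUAL-CASES §a.2. [folklore] -/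
def residual (h : Header) (b : Bits) : Cls :=
  if h.cm then .X12
  else if b.p == 2 then .Up2
  else if b.isog then
    (if b.good then (if h.rank == 1 && !b.gvpar then .X1a else .X1b) else if b.mult then .X2 else .X3)
  else if b.add then .X4
  else if b.mult then (if h.rank == 0 then .X11a else .X11b)
  else if b.ss then (if b.p == 3 && b.ap != 0 then .X8 else if h.sst then .X6 else .X7)
  else if decide (5 ≤ b.p) then .X9
  else .X10b

/-- One `(E, p)` entry: the bits and the recorded decision — `rows` = the applicable rows in order, `status`,
the credited `row` with its `flags`, or the residual `cls`. [folklore] -/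
structure Entry where
  bits : Bits
  rows : List Row
  status : Status
  row : Option Row
  flags : List Flag
  cls : Option Cls
  deriving DecidableEq, Repr

/-- The decision RECOMPUTED from the bits: credited = first flag-free applicable row (status `proved`), else the
first applicable row with its flag (status `literal`), else `residue` with the residual class; a non-CM or rank-1
curve's `p = 2` entry is `unattempted`/`Up2`. [folklore] -/
def decided (h : Header) (b : Bits) : Status × Option Row × List Flag × Option Cls :=
  let app := applicable h b
  if b.p == 2 && !(h.cm && h.rank == 0) then (.unattempted, none, [], some .Up2)
  else match app.find? (fun rf => rf.2.isNone), app with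
    | some (rw, _), _ => (.proved, some rw, [], none)
    | none, (rw, some f) :: _ => (.literal, some rw, [f], none)
    | none, _ => (.residue, none, [], some (residual h b))

/-- An entry is consistent when its recorded rows and decision are the recomputed ones. [folklore] -/
def Entry.consistent (h : Header) (e : Entry) : Bool :=
  (e.rows == (applicable h e.bits).map (·.1)) &&
  (decided h e.bits == (e.status, e.row, e.flags, e.cls))

/-- The tail row of a class from its header and whether Zywina's exceptional set was formed. [folklore] -/
def tailOf (h : Header) (zywina : Bool) : Tail :=
  if h.cm then (if h.rank == 0 then .BF24 else .CMr1)
  else if !zywina then .GaloisUncertified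
  else if h.rank == 0 then .KATO
  else if h.sst then .JSWBCS
  else .X7T

/-- The status a tail contributes to the verdict. [folklore] -/
def Tail.status : Tail → Verdict
  | .KATO => .proved | .BF24 => .proved | .JSWBCS => .literal | .CMr1 => .literal
  | .X7T => .residue | .GaloisUncertified => .residue

/-- The class verdict over the odd primes and the tail: `residue` if some odd-prime entry is open or the tail is
open; else `literal` if some credited row or the tail carries a flag; else `proved`. [folklore] -/
def verdictOf (es : List Entry) (t : Tail) : Verdict :=
  if es.any (fun e => e.status == .residue) || t.status == .residue then .residue
  else if es.any (fun e => e.status == .literal) || t.status == .literal then .literal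
  else .proved

/-- One swept Cremona class: label and a-invariants of curve `#1`, conductor, header (rank, CM, semistable),
whether Zywina's exceptional set was formed, the per-prime entries for `S₀(E)` (increasing `p`), the tail and the
verdict, and provenance strings (engine, job) — documentation only. [cite: Cremona2006, §1 (labels, tables)] -/
structure Curve where
  label : String
  ainvs : List ℤ
  conductor : ℕ
  header : Header
  zywina : Bool
  entries : List Entry
  tail : Tail
  verdict : Verdict
  engine : String
  deriving DecidableEq, Repr

/-- Consistency of a class record: five a-invariants, rank `≤ 1`, entries at distinct increasing primes containing
`2` and `3`, every entry consistent, tail and verdict recomputed. [folklore] -/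
def Curve.consistent (c : Curve) : Bool :=
  (c.ainvs.length == 5) && decide (c.header.rank ≤ 1) &&
  (c.entries.map (·.bits.p)).Pairwise (· < ·) &&
  (c.entries.map (·.bits.p)).contains 2 && (c.entries.map (·.bits.p)).contains 3 &&
  c.entries.all (Entry.consistent c.header) &&
  (c.tail == tailOf c.header c.zywina) &&
  (c.verdict == verdictOf c.entries c.tail)

/-- A list of class records is `Swept` when every one is consistent: the statement of each generated theorem
`theorem sweep_<label> : Swept [ … ] := by decide` of the files `Records*.lean`. [folklore] -/
def Swept (cs : List Curve) : Prop := cs.all Curve.consistent = true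

/-- `Swept cs` is decidable. [folklore] -/
instance Swept.instDecidable (cs : List Curve) : Decidable (Swept cs) :=
  inferInstanceAs (Decidable (cs.all Curve.consistent = true))

/-- Unpacking `Swept`. [folklore] -/
theorem Swept.consistent_of_mem {cs : List Curve} (h : Swept cs) {c : Curve} (hc : c ∈ cs) :
    c.consistent = true :=
  List.all_eq_true.1 h c hc

/-- `Swept` of a `cons`. [folklore] -/
theorem Swept.cons_iff (c : Curve) (cs : List Curve) : Swept (c :: cs) ↔ c.consistent = true ∧ Swept cs := by
  simp [Swept, List.all_cons]

/-- The empty sweep. [folklore] -/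
theorem Swept.nil : Swept [] := by decide

/-- SAMPLE (and regression test of the recheck): `11a1` (`N = 11`, rank 0, non-CM, semistable; `S₀ = {2,3,5,7,11,13}`;
`Ш_an = 1`, `∏c_ℓ = c₁₁ = 5`, `#E(ℚ)_tors = 5`, rational `5`-isogeny, `ρ̄` onto for `p ≠ 5`): at `3, 7, 13` Skinner's
Thm C (ram witness `q = 11`, `v₁₁(Δ) = 5`), with BCS/Kato/Wuthrich/Kim also applicable at `7, 13`; at `5` (Eisenstein,
anomalous: `a₅ = 1`) Wuthrich's Prop. 21; at `11` (split multiplicative, no (ram) prime) Wuthrich's Prop. 21; tail Kato;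
verdict `proved`. [cite: Wuthrich2014, Prop. 21 (p. 400)] -/
theorem swept_sample : Swept [
  { label := "11a1", ainvs := [0, -1, 1, -10, -20], conductor := 11, header := ⟨0, false, true⟩, zywina := true,
    entries := [
      ⟨⟨2, .goodSS, -2, false, true, true, 0, 0, 0, [0], true, false, false, false⟩, [], .unattempted, none, [], some .Up2⟩,
      ⟨⟨3, .goodOrd, -1, false, true, true, 0, 0, 0, [0], true, false, false, false⟩, [.SK, .YZ26, .WU14], .proved, some .SK, [], none⟩,
      ⟨⟨5, .goodOrd, 1, true, false, false, 0, 0, 1, [-1], true, false, false, false⟩, [.WU14], .proved, some .WU14, [], none⟩,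
      ⟨⟨7, .goodOrd, -2, false, true, true, 0, 0, 0, [0], true, false, false, false⟩, [.SK, .BCS, .KATO, .WU14, .KIM0], .proved, some .SK, [], none⟩,
      ⟨⟨11, .split, 1, false, true, false, 0, 0, 0, [0], true, false, false, false⟩, [.WU14, .KIM0], .proved, some .WU14, [], none⟩,
      ⟨⟨13, .goodOrd, 4, false, true, true, 0, 0, 0, [0], true, false, false, false⟩, [.SK, .BCS, .KATO, .WU14, .KIM0], .proved, some .SK, [], none⟩],
    tail := .KATO, verdict := .proved, engine := "sweep2/2026-08-18a" } ] := by
  decide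

/-- Tampering is caught: crediting Kato at `p = 5` for `11a1` (where `E[5]` is reducible) is NOT consistent.
[folklore] -/
theorem not_swept_tampered : ¬ Swept [
  { label := "11a1", ainvs := [0, -1, 1, -10, -20], conductor := 11, header := ⟨0, false, true⟩, zywina := true,
    entries := [
      ⟨⟨2, .goodSS, -2, false, true, true, 0, 0, 0, [0], true, false, false, false⟩, [], .unattempted, none, [], some .Up2⟩,
      ⟨⟨3, .goodOrd, -1, false, true, true, 0, 0, 0, [0], true, false, false, false⟩, [.SK, .YZ26, .WU14], .proved, some .SK, [], none⟩,
      ⟨⟨5, .goodOrd, 1, true, false, false, 0, 0, 1, [-1], true, false, false, false⟩, [.KATO], .proved, some .KATO, [], none⟩],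
    tail := .KATO, verdict := .proved, engine := "sweep2/2026-08-18a" } ] := by
  decide

end Literature.NumberTheory.EllipticCurves.HypothesisSweep
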